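import Summits.HodgeConjecture.HodgeConjecture.Theorems.F0P6aSpecOrgansURoofKernelUnique
import HarnessLib

/-!
# `F0P6aSpecOrgansUTwoRoofLegs` — ★ RE-HOME of `Lines/F0_P6a_SpecOrgansU.lean` (tree sha16 c0cd5fc2e87636d7, 1347 l.), PART 3 of 5 — tree lines :676–:971
See PART 1 `Theorems/F0P6aSpecOrgansUBlockJ.lean` for the full ★ re-home header and the original module docstring (verbatim there).  Same namespace (every
fully-qualified name unchanged); the scopes open at the cut are re-opened below with their `variable` ∕ `open` ∕ `set_option` ∕ `universe` lines replayed verbatim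
from the tree, in order; the code after the replay block is the tree bytes :676–:971, untouched except the (d1) cure named in PART 1.  HC_CM is proved only modulo the 7 printed citations (2 remaining: hLiu418 = stmt-HodgeConjecture-24832, h413 = stmt-HodgeConjecture-24833) until rung 0 closes; a re-home is count-neutral.
-/

-- ── replay of the scopes open at tree line :676 (verbatim) ──
set_option autoImplicit false
set_option linter.dupNamespace false
noncomputable section
namespace Summit.HodgeConjecture.HodgeConjecture.Cruxes.HLiu418.F0P6aLineSpecialisation
section Block_C6Ω
universe u
open CategoryTheory CategoryTheory.Limits AlgebraicGeometry MonoidalCategory CartesianMonoidalCategory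
open scoped MonObj
open Literature.AlgebraicGeometry.Motives Literature.AlgebraicGeometry.GroupSchemes Literature.AlgebraicGeometry.GroupSchemes.GroupSchemeKernel
open Literature.AlgebraicGeometry.GroupSchemes.AffineGroupScheme Literature.AlgebraicGeometry.GroupSchemes.TorsionLayer
section RoofKernelUnique
set_option backward.isDefEq.respectTransparency false
open NumberField IsDedekindDomain MulAction
open scoped Matrix Pointwise
open Literature.NumberTheory.GaloisRepresentations
open Literature.NumberTheory.Automorphic Literature.NumberTheory.Automorphic.UnitaryGroup
open Literature.AlgebraicGeometry.ShimuraVarieties.UnitaryCanonicalModel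
open Literature.NumberTheory.Automorphic.Liu2021.AppendixC
open Literature.AlgebraicGeometry.Motives (AlgPoints IntegralModel SchemeOver thickening thickeningGalAction thickeningLift specOver)
open Literature.NumberTheory.DiophantineGeometry (geomResidueField specialFibreFunctor specResidueField)
open Literature.NumberTheory.EllipticCurves (specGenericPoint)
open Literature.AlgebraicGeometry.RelativeSpec (ActionOver)
open Literature.AlgebraicGeometry.AbelianSchemes Literature.AlgebraicGeometry.AbelianSchemes.AbelianSchemeOver
open Summit.HodgeConjecture.HodgeConjecture.Cruxes.HLiu418.F0P6aModuliDatumDefs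
open Summit.HodgeConjecture.HodgeConjecture.Cruxes.HLiu418.F0P6aRGDAssembly
open Summit.HodgeConjecture.HodgeConjecture.Cruxes.HLiu418.F0P6aDatumOfInputs
variable {F : Type} [Field F] [NumberField F] [IsCMField F] {ι₁ : F →+* ℂ}
    {Jstar : Matrix (Fin 2) (Fin 2) F}
    {K₀ : C5.OpenCompactSubgroup ↥(finAdelic ↥(maximalRealSubfield F) F (IsCMField.complexConj F) 2 Jstar)}
    {S : RecordSystemGS F Jstar ι₁ K₀} {hU7ₛ : S.HeckeTranslateDefinedOver}
    {hJ : (Jstar.map (IsCMField.complexConj F))ᵀ = Jstar} {hJu : IsUnit Jstar}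
    {Fi : Type} [Field Fi] [Algebra F Fi] {Kc : C5.SmallLevel K₀} {G : Type} [Group G]
    {𝓜 : IntegralModel (𝓞 F) F ((thickening F Fi).obj (S.M.obj Kc))}
    {w : HeightOneSpectrum (𝓞 F)} {hw : (IsCMField.complexConj F) • w ≠ w} {h𝓨 : (𝓜.localise w).IsSmoothProper 1}
    {θ : ActionOver (𝓜.localise w).total.hom ((Fi ≃ₐ[F] Fi) × G)}
    {e : Fi →ₐ[F] AlgebraicClosure (w.adicCompletion F)}

set_option maxHeartbeats 400000 in
/-- **(C6′-Ω)-OF-CUT `comp_eq_one_iff_of_two_roofLegs_of_cut`** (port of LA2-p04 (g2)'s `…_of_two_quotLegs_of_cut`) — the second half, stated over the OUTPUT of (s-H2)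
★ `exists_twoBlock_hermitianDuality_pairing` at `A_y` (`G′ = A_y[𝔭_w𝔭_{c•w}]` realised by `j′` with its points clause `hj′`, the duality `e`, the idempotents `εW εV` with
`hεVj hsum hVV hadj`, the pairing clause `hpair`, the `p`-torsion row `hG′p`) plus the two legs' rows ((r1) on Ω̄-points `hr1ᵢ`, (r3) `hSIMᵢ`, (r4) at `e_{c•w}` with a bare
intertwiner `bᵢ` and `η ≫ bᵢ = η`, (K2-Ω) `hKᵢ`, (RK) `hrkᵢ`) and the common `c•w`-part `hcw`: (s-REAL) ★ `exists_interLayer`, (s-LAG) `lag_of_roofLeg`, `εV`-stability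
`exists_comp_eq_comp_of_comm`, and — NO DOCK UPSTAIRS — the `εV`-FIXED LAYER `W ↪ G′` (★ `exists_fixedLayer`), finite étale in characteristic `0` (★
`etale_hom_of_forall_pow_eq_one`), on which «same `c•w`-part on Ω̄-points» upgrades to all `T`-points (★ `comp_eq_one_iff_of_forall_algPoint`); then (C6′-core).
Split off so that every declaration stays ≤ 400 000 heartbeats. [cite: MumfordAV1970, §23 Thm. 2 (p. 231)]
[cite: Tate1997FiniteFlatGroupSchemes, §(3.8) pp. 145–146] [cite: Liu2021, Prop. D.8 p. 135, p. 137] -/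
theorem comp_eq_one_iff_of_two_roofLegs_of_cut (I : RGDInputsAt F ι₁ Jstar K₀ S hU7ₛ hJ hJu Fi Kc G 𝓜 w hw h𝓨 θ e)
    (y : AlgPoints (S.M.obj Kc) (AlgebraicClosure (w.adicCompletion F)))
    -- the CRT element of the `c•w`-block and its membership
    (ecw : 𝓞 F) (hecw𝔭 : ecw ∈ w.asIdeal)
    -- the cut (output of ★ `exists_twoBlock_hermitianDuality_pairing` at `A_y`, `I := 𝔭_w𝔭_{c•w}`)
    (G' : SchemeOver (AlgebraicClosure (w.adicCompletion F))) [GrpObj G'] [IsCommMonObj G'] [IsAffine G'.left]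
    [Module.Free (AlgebraicClosure (w.adicCompletion F)) (Alg G')] [Module.Finite (AlgebraicClosure (w.adicCompletion F)) (Alg G')]
    (j' : G' ⟶ (schΩOf S Kc 𝓜 w e I.univ y).toAffine.toAbelianVariety.X) [IsMonHom j'] [IsClosedImmersion j'.left]
    (e𝒟 : G' ≅ cartierDual G') (εW εV : G' ⟶ G') [IsMonHom εV]
    (hj' : ∀ ⦃T : SchemeOver (AlgebraicClosure (w.adicCompletion F))⦄ (t : T ⟶ (schΩOf S Kc 𝓜 w e I.univ y).toAffine.toAbelianVariety.X),
      (∃ s : T ⟶ G', s ≫ j' = t) ↔ ∀ a ∈ w.asIdeal * ((IsCMField.complexConj F) • w).asIdeal, t ≫ (actΩOf S Kc 𝓜 w e I.univ I.act a y).hom.hom.hom = 1)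
    (hεVj : εV ≫ j' = j' ≫ (actΩOf S Kc 𝓜 w e I.univ I.act ecw y).hom.hom.hom)
    (hsumε : εW * εV = 𝟙 G') (hVV : εV ≫ εV = εV) (hadj : εW ≫ e𝒟.hom = e𝒟.hom ≫ cartierDualMap εV)
    (hpair : ∀ ⦃T : Type⦄ [CommRing T] [Algebra (AlgebraicClosure (w.adicCompletion F)) T] [Module.Finite (AlgebraicClosure (w.adicCompletion F)) T]
      (t s : specOver (AlgebraicClosure (w.adicCompletion F)) T ⟶ G')
      (ht : ((t ≫ j') ≫ (polΩOf S Kc 𝓜 w e I.univ I.pol y).lam) ^ (I.pChar ^ 1) = 1) (hs : (s ≫ j') ^ (I.pChar ^ 1) = 1),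
      cartierPairing G' (t ≫ e𝒟.hom) s =
        (dualΩOf S Kc 𝓜 w e I.univ I.dual y).weilChar (polΩOf S Kc 𝓜 w e I.univ I.pol y).nonempty_unitHatSlice_iso (I.pChar ^ 1)
          ((t ≫ j') ≫ (polΩOf S Kc 𝓜 w e I.univ I.pol y).lam) ht (s ≫ j') hs)
    (hG'p : ∀ ⦃T : SchemeOver (AlgebraicClosure (w.adicCompletion F))⦄ (t : T ⟶ G'), (t ≫ j') ^ (I.pChar ^ 1) = 1)
    -- (RKG)
    (hrkG' : Module.finrank (AlgebraicClosure (w.adicCompletion F)) (Alg G') = (I.pChar ^ I.fDeg * I.pChar ^ I.fDeg) * (I.pChar ^ I.fDeg * I.pChar ^ I.fDeg))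
    -- the two legs
    {B₁ B₂ : AbelianSchemeOver (Spec (CommRingCat.of (AlgebraicClosure (w.adicCompletion F))))}
    (ψ₁ : (schΩOf S Kc 𝓜 w e I.univ y).X ⟶ B₁.X) [IsMonHom ψ₁]
    (ψ₂ : (schΩOf S Kc 𝓜 w e I.univ y).X ⟶ B₂.X) [IsMonHom ψ₂]
    (DB₁ : B₁.DualPair)
    (hDB₁ : Nonempty ((Scheme.Modules.pullback (DualPair.unitHatSlice DB₁)).obj DB₁.P ≅ SheafOfModules.unit _))
    (lamB₁ : B₁.X ⟶ DB₁.hat.X) [IsMonHom lamB₁]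
    (hSIM₁ : ψ₁ ≫ lamB₁ ≫ DualPair.dualIsogenyOver ψ₁ (dualΩOf S Kc 𝓜 w e I.univ I.dual y) DB₁ =
      (polΩOf S Kc 𝓜 w e I.univ I.pol y).lam ≫ (dualΩOf S Kc 𝓜 w e I.univ I.dual y).hat.mulN I.pChar)
    (DB₂ : B₂.DualPair)
    (hDB₂ : Nonempty ((Scheme.Modules.pullback (DualPair.unitHatSlice DB₂)).obj DB₂.P ≅ SheafOfModules.unit _))
    (lamB₂ : B₂.X ⟶ DB₂.hat.X) [IsMonHom lamB₂]
    (hSIM₂ : ψ₂ ≫ lamB₂ ≫ DualPair.dualIsogenyOver ψ₂ (dualΩOf S Kc 𝓜 w e I.univ I.dual y) DB₂ =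
      (polΩOf S Kc 𝓜 w e I.univ I.pol y).lam ≫ (dualΩOf S Kc 𝓜 w e I.univ I.dual y).hat.mulN I.pChar)
    -- (r4) at `e_{c•w}`: bare intertwiners preserving the unit
    (b₁ : B₁.X ⟶ B₁.X) (hb₁ : η[B₁.X] ≫ b₁ = η[B₁.X]) (hACT₁ : (actΩOf S Kc 𝓜 w e I.univ I.act ecw y).hom.hom.hom ≫ ψ₁ = ψ₁ ≫ b₁)
    (b₂ : B₂.X ⟶ B₂.X) (hb₂ : η[B₂.X] ≫ b₂ = η[B₂.X]) (hACT₂ : (actΩOf S Kc 𝓜 w e I.univ I.act ecw y).hom.hom.hom ≫ ψ₂ = ψ₂ ≫ b₂)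
    (hK₁ : ∀ ⦃T : SchemeOver (AlgebraicClosure (w.adicCompletion F))⦄ (t : T ⟶ (schΩOf S Kc 𝓜 w e I.univ y).X), t ≫ ψ₁ = 1 →
      ∀ a ∈ w.asIdeal * ((IsCMField.complexConj F) • w).asIdeal, t ≫ (actΩOf S Kc 𝓜 w e I.univ I.act a y).hom.hom.hom = 1)
    (hK₂ : ∀ ⦃T : SchemeOver (AlgebraicClosure (w.adicCompletion F))⦄ (t : T ⟶ (schΩOf S Kc 𝓜 w e I.univ y).X), t ≫ ψ₂ = 1 →
      ∀ a ∈ w.asIdeal * ((IsCMField.complexConj F) • w).asIdeal, t ≫ (actΩOf S Kc 𝓜 w e I.univ I.act a y).hom.hom.hom = 1)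
    -- (r1) on Ω̄-points and the common `c•w`-part
    (Kp₁ Kp₂ : Subgroup ((fibreΩOf S Kc 𝓜 w e I.univ y).Points (AlgebraicClosure (w.adicCompletion F))))
    (hr1₁ : ∀ P : (fibreΩOf S Kc 𝓜 w e I.univ y).Points (AlgebraicClosure (w.adicCompletion F)),
      (AlgPoints.map ψ₁ P : B₁.toAffine.toAbelianVariety.Points (AlgebraicClosure (w.adicCompletion F))) = 1 ↔ P ∈ Kp₁)
    (hr1₂ : ∀ P : (fibreΩOf S Kc 𝓜 w e I.univ y).Points (AlgebraicClosure (w.adicCompletion F)),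
      (AlgPoints.map ψ₂ P : B₂.toAffine.toAbelianVariety.Points (AlgebraicClosure (w.adicCompletion F))) = 1 ↔ P ∈ Kp₂)
    (hcw : ∀ P : (fibreΩOf S Kc 𝓜 w e I.univ y).Points (AlgebraicClosure (w.adicCompletion F)),
      (P ∈ Kp₁ ∧ IsIdealTorsionΩ S Kc 𝓜 w e I.univ I.act y ((IsCMField.complexConj F) • w).asIdeal P) ↔
        (P ∈ Kp₂ ∧ IsIdealTorsionΩ S Kc 𝓜 w e I.univ I.act y ((IsCMField.complexConj F) • w).asIdeal P))
    (hrk₁ : ∀ (K : SchemeOver (AlgebraicClosure (w.adicCompletion F))) [GrpObj K] [IsAffine K.left] [Module.Finite (AlgebraicClosure (w.adicCompletion F)) (Alg K)]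
      (κ : K ⟶ (schΩOf S Kc 𝓜 w e I.univ y).X) [IsMonHom κ] [IsClosedImmersion κ.left],
      (∀ ⦃T : SchemeOver (AlgebraicClosure (w.adicCompletion F))⦄ (t : T ⟶ (schΩOf S Kc 𝓜 w e I.univ y).X), (∃ s : T ⟶ K, s ≫ κ = t) ↔ t ≫ ψ₁ = 1) →
      Module.finrank (AlgebraicClosure (w.adicCompletion F)) (Alg K) = I.pChar ^ I.fDeg * I.pChar ^ I.fDeg)
    (hrk₂ : ∀ (K : SchemeOver (AlgebraicClosure (w.adicCompletion F))) [GrpObj K] [IsAffine K.left] [Module.Finite (AlgebraicClosure (w.adicCompletion F)) (Alg K)]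
      (κ : K ⟶ (schΩOf S Kc 𝓜 w e I.univ y).X) [IsMonHom κ] [IsClosedImmersion κ.left],
      (∀ ⦃T : SchemeOver (AlgebraicClosure (w.adicCompletion F))⦄ (t : T ⟶ (schΩOf S Kc 𝓜 w e I.univ y).X), (∃ s : T ⟶ K, s ≫ κ = t) ↔ t ≫ ψ₂ = 1) →
      Module.finrank (AlgebraicClosure (w.adicCompletion F)) (Alg K) = I.pChar ^ I.fDeg * I.pChar ^ I.fDeg)
    ⦃T : SchemeOver (AlgebraicClosure (w.adicCompletion F))⦄ (t : T ⟶ (schΩOf S Kc 𝓜 w e I.univ y).X) :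
    t ≫ ψ₁ = 1 ↔ t ≫ ψ₂ = 1 := by
  classical
  haveI : CharZero (w.adicCompletion F) := charZero_of_injective_algebraMap (algebraMap F (w.adicCompletion F)).injective
  haveI : CharZero (AlgebraicClosure (w.adicCompletion F)) :=
    charZero_of_injective_algebraMap (algebraMap (w.adicCompletion F) (AlgebraicClosure (w.adicCompletion F))).injective
  let A₀ : AbelianSchemeOver (Spec (.of (AlgebraicClosure (w.adicCompletion F)))) := schΩOf S Kc 𝓜 w e I.univ y
  let Av : AbelianVariety (AlgebraicClosure (w.adicCompletion F)) := A₀.toAffine.toAbelianVariety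
  let act : 𝓞 F → (Av ⟶ Av) := fun a => actΩOf S Kc 𝓜 w e I.univ I.act a y
  let ρ₀ : A₀.RingAction (𝓞 F) := actΩROf I y
  have hact : ∀ a, (act a).hom.hom.hom = ρ₀.i a := fun a => rfl
  let Iw : Ideal (𝓞 F) := w.asIdeal * ((IsCMField.complexConj F) • w).asIdeal
  have hp : I.pChar.Prime := I.hpChar.1
  -- ===================== (8) (s-REAL): `Kᵢ := Ker (j′ ≫ ψᵢ) ↪ G′` (★ `exists_interLayer`) =====================
  haveI : IsProper B₁.X.hom := B₁.isProper
  haveI : IsProper B₂.X.hom := B₂.isProper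
  obtain ⟨K₁, k11, k12, k13, k14, k15, κ₁, hκ₁m, hκ₁ci, hκ₁⟩ := exists_interLayer G' (j' ≫ ψ₁)
  obtain ⟨K₂, k21, k22, k23, k24, k25, κ₂, hκ₂m, hκ₂ci, hκ₂⟩ := exists_interLayer G' (j' ≫ ψ₂)
  haveI := hκ₁m; haveI := hκ₁ci; haveI := hκ₂m; haveI := hκ₂ci
  haveI : Mono κ₁ := Over.mono_of_mono_left κ₁
  haveI : Mono κ₂ := Over.mono_of_mono_left κ₂
  have hκ₁' : ∀ ⦃T : SchemeOver (AlgebraicClosure (w.adicCompletion F))⦄ (t : T ⟶ G'), (∃ s : T ⟶ K₁, s ≫ κ₁ = t) ↔ (t ≫ j') ≫ ψ₁ = 1 := fun T t => by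
    rw [hκ₁ t, Category.assoc]
  have hκ₂' : ∀ ⦃T : SchemeOver (AlgebraicClosure (w.adicCompletion F))⦄ (t : T ⟶ G'), (∃ s : T ⟶ K₂, s ≫ κ₂ = t) ↔ (t ≫ j') ≫ ψ₂ = 1 := fun T t => by
    rw [hκ₂ t, Category.assoc]
  have hreal₁ := real_comp_of_roofLeg I y G' j' hj' ψ₁ hK₁ K₁ κ₁ hκ₁'
  have hreal₂ := real_comp_of_roofLeg I y G' j' hj' ψ₂ hK₂ K₂ κ₂ hκ₂'
  -- ===================== (9) THE RANK ROW `rk G′ = rk Kᵢ · rk Kᵢ` (by value) =====================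
  haveI : IsClosedImmersion (κ₁ ≫ j').left := by rw [Over.comp_left]; infer_instance
  haveI : IsClosedImmersion (κ₂ ≫ j').left := by rw [Over.comp_left]; infer_instance
  have hrkK₁ : Module.finrank (AlgebraicClosure (w.adicCompletion F)) (Alg K₁) = I.pChar ^ I.fDeg * I.pChar ^ I.fDeg := hrk₁ K₁ (κ₁ ≫ j') hreal₁
  have hrkK₂ : Module.finrank (AlgebraicClosure (w.adicCompletion F)) (Alg K₂) = I.pChar ^ I.fDeg * I.pChar ^ I.fDeg := hrk₂ K₂ (κ₂ ≫ j') hreal₂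
  -- ===================== (10) (s-LAG) =====================
  have hlag₁ : ∀ ⦃T : SchemeOver (AlgebraicClosure (w.adicCompletion F))⦄ (t : T ⟶ G'), (∃ s : T ⟶ K₁, s ≫ κ₁ = t) ↔ (t ≫ e𝒟.hom) ≫ cartierDualMap κ₁ = 1 :=
    lag_of_roofLeg I y G' j' e𝒟 hpair hG'p ψ₁ DB₁ hDB₁ lamB₁ hSIM₁ K₁ κ₁ ((hκ₁' κ₁).1 ⟨𝟙 _, Category.id_comp _⟩) (by rw [hrkG', hrkK₁])
  have hlag₂ : ∀ ⦃T : SchemeOver (AlgebraicClosure (w.adicCompletion F))⦄ (t : T ⟶ G'), (∃ s : T ⟶ K₂, s ≫ κ₂ = t) ↔ (t ≫ e𝒟.hom) ≫ cartierDualMap κ₂ = 1 :=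
    lag_of_roofLeg I y G' j' e𝒟 hpair hG'p ψ₂ DB₂ hDB₂ lamB₂ hSIM₂ K₂ κ₂ ((hκ₂' κ₂).1 ⟨𝟙 _, Category.id_comp _⟩) (by rw [hrkG', hrkK₂])
  -- ===================== (11) `ε_V`-STABILITY of `Kᵢ` ((C6′-stab′), (r4) at `e_{c•w}`) =====================
  have hV₁ := AffineGroupScheme.exists_comp_eq_comp_of_comm G' j' εV K₁ κ₁ ψ₁ (act ecw).hom.hom.hom b₁ hb₁ hεVj hACT₁ hκ₁'
  have hV₂ := AffineGroupScheme.exists_comp_eq_comp_of_comm G' j' εV K₂ κ₂ ψ₂ (act ecw).hom.hom.hom b₂ hb₂ hεVj hACT₂ hκ₂'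
  -- ===================== (12) NO DOCK: the `ε_V`-FIXED LAYER `W ↪ G′`, finite étale; same `c•w`-part on Ω̄-points ⟹ on all `T`-points =====================
  -- (12a) `ε_V`-fixed points are `𝔭_{c•w}`-torsion (`e_{c•w} ∈ 𝔭_w`, `G′` is `𝔭_w𝔭_{c•w}`-torsion)
  have hfixcw : ∀ ⦃T : SchemeOver (AlgebraicClosure (w.adicCompletion F))⦄ (t : T ⟶ G'), t ≫ εV = t →
      ∀ r ∈ ((IsCMField.complexConj F) • w).asIdeal, (t ≫ j') ≫ (act r).hom.hom.hom = 1 := by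
    intro T t ht r hr
    have hmem : r * ecw ∈ Iw := by
      rw [mul_comm r ecw]
      exact Ideal.mul_mem_mul hecw𝔭 hr
    have h := (hj' (t ≫ j')).1 ⟨t, rfl⟩ (r * ecw) hmem
    rw [hact, ρ₀.comp_i_mul] at h
    change ((t ≫ j') ≫ (act ecw).hom.hom.hom) ≫ ρ₀.i r = 1 at h
    rw [Category.assoc t j', ← hεVj, ← Category.assoc, ht] at h
    exact h
  -- (12b) the fixed layer
  obtain ⟨Wf, w1, w2, w3, w4, w5, jW, hjWm, hjWci, hWf⟩ := exists_fixedLayer G' εV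
  haveI := hjWm; haveI := hjWci
  haveI : IsClosedImmersion (jW ≫ j').left := by rw [Over.comp_left]; infer_instance
  -- `W` is killed by `p`, hence étale (characteristic `0`)
  have hpΩ : ((I.pChar : ℤ) : (AlgebraicClosure (w.adicCompletion F))) ≠ 0 := by exact_mod_cast hp.ne_zero
  haveI : Etale Wf.hom := AbelianVariety.etale_hom_of_forall_pow_eq_one (jW ≫ j') (I.pChar : ℤ) hpΩ fun T u => by
    rw [zpow_natCast, ← Category.assoc]
    have h := hG'p (u ≫ jW)
    rwa [pow_one] at h
  haveI : IsFinite Wf.hom := isFinite_hom_of_finite_alg Wf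
  -- the two kernels on `W` are finite étale
  haveI : IsClosedImmersion (kerι ((jW ≫ j') ≫ ψ₁)).left := isClosedImmersion_kerι_left_of_isSeparated _
  haveI : IsClosedImmersion (kerι ((jW ≫ j') ≫ ψ₂)).left := isClosedImmersion_kerι_left_of_isSeparated _
  haveI : Etale (ker ((jW ≫ j') ≫ ψ₁)).hom := etale_hom_of_isClosedImmersion_of_etale (kerι ((jW ≫ j') ≫ ψ₁))
  haveI : Etale (ker ((jW ≫ j') ≫ ψ₂)).hom := etale_hom_of_isClosedImmersion_of_etale (kerι ((jW ≫ j') ≫ ψ₂))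
  haveI : IsFinite (ker ((jW ≫ j') ≫ ψ₁)).hom := isFinite_hom_of_isClosedImmersion (kerι ((jW ≫ j') ≫ ψ₁))
  haveI : IsFinite (ker ((jW ≫ j') ≫ ψ₂)).hom := isFinite_hom_of_isClosedImmersion (kerι ((jW ≫ j') ≫ ψ₂))
  -- (12c) on Ω̄-points of `W` the two kernels agree (`hcw` + (r1) + (12a))
  have hWpts : ∀ P : specOver (AlgebraicClosure (w.adicCompletion F)) (AlgebraicClosure (w.adicCompletion F)) ⟶ Wf, P ≫ ((jW ≫ j') ≫ ψ₁) = 1 ↔ P ≫ ((jW ≫ j') ≫ ψ₂) = 1 := by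
    intro P
    have hfix : (P ≫ jW) ≫ εV = P ≫ jW := (hWf (P ≫ jW)).1 ⟨P, rfl⟩
    have hcwP : IsIdealTorsionΩ S Kc 𝓜 w e I.univ I.act y ((IsCMField.complexConj F) • w).asIdeal (P ≫ jW ≫ j') := fun r hr => by
      have h := hfixcw (P ≫ jW) hfix r hr
      rw [Category.assoc] at h
      exact h
    have h₁ : P ≫ ((jW ≫ j') ≫ ψ₁) = 1 ↔ (P ≫ jW ≫ j') ∈ Kp₁ := by
      rw [← hr1₁]; simp only [Category.assoc]; rfl
    have h₂ : P ≫ ((jW ≫ j') ≫ ψ₂) = 1 ↔ (P ≫ jW ≫ j') ∈ Kp₂ := by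
      rw [← hr1₂]; simp only [Category.assoc]; rfl
    rw [h₁, h₂]
    exact ⟨fun h => ((hcw _).1 ⟨h, hcwP⟩).1, fun h => ((hcw _).2 ⟨h, hcwP⟩).1⟩
  -- (12d) ⟹ on all `T`-points of `W` (★ kernels decided on points), i.e. ★ (BLK)'s `hV`
  have hV : ∀ ⦃T : SchemeOver (AlgebraicClosure (w.adicCompletion F))⦄ (t : T ⟶ G'), t ≫ εV = t →
      ((∃ s : T ⟶ K₁, s ≫ κ₁ = t) ↔ ∃ s : T ⟶ K₂, s ≫ κ₂ = t) := by
    intro T t ht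
    obtain ⟨s, rfl⟩ := (hWf t).2 ht
    rw [hκ₁', hκ₂']
    have key := GroupSchemeKernel.comp_eq_one_iff_of_forall_algPoint ((jW ≫ j') ≫ ψ₁) ((jW ≫ j') ≫ ψ₂) hWpts s
    simp only [Category.assoc] at key ⊢
    exact key
  -- ===================== (13) (C6′-core) =====================
  exact AffineGroupScheme.comp_eq_one_iff_of_blocks G' j' e𝒟 εW εV K₁ κ₁ K₂ κ₂ ψ₁ ψ₂ (Iw : Set (𝓞 F)) (fun a => (act a).hom.hom.hom) hj' hK₁ hK₂ hκ₁' hκ₂'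
    hsumε hVV hadj hlag₁ hlag₂ hV₁ hV₂ hV t


/-! #### §2.Z HEAD -/

set_option maxHeartbeats 400000 in
set_option backward.isDefEq.respectTransparency false in
/-- **(C6′-Ω) `roofKernel_eq_of_cw_eq` — TWO ROOF KERNELS IN THE GENERIC FIBRE `A_y` WITH THE SAME `c•w`-PART ARE EQUAL.**  For `y, t₁, t₂ ∈ M_{Kc}(Ω̄)` and finite
subgroups `K₁, K₂ ≤ A_y(Ω̄)` that are ROOF KERNELS (`RoofΩ … y tᵢ Kᵢ`: legs `qᵢ : A_y → Bᵢ` with `Ker qᵢ(Ω̄) = Kᵢ`, `qᵢ^*λ_{Bᵢ} = λ_y ≫ [p]`, common equivariance, …) of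
order `q² = p^{2f}` each, with `p` unramified at `w` (`hunr`): if `K₁ ∩ A_y[𝔭_{c•w}](Ω̄) = K₂ ∩ A_y[𝔭_{c•w}](Ω̄)` then `K₁ = K₂`.  (The generic-fibre twin of (C6′)
`comp_eq_one_iff_of_two_quotLegs`: both kernels lie in the two-block cut `A_y[𝔭_w𝔭_{c•w}]`, are LAGRANGIAN for the Weil duality cut out by `λ_y` (similitude factor EXACTLY
`p`), are `ε_V = ι(e_{c•w})`-stable, and have the same `V`-part; ★ (BLK).)  Text of record LA2-plan (g2) 09:18:21Z (iii) with `[ExpChar …]` dropped (09:24:39Z).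
[cite: MumfordAV1970, §23 Thm. 2 (p. 231), §20 (I) (p. 186)] [cite: Tate1997FiniteFlatGroupSchemes, §(3.8) pp. 145–146] [cite: Liu2021, Prop. D.8 (2) p. 135, p. 137]
[cite: RapoportSmithlingZhang2020Diagonal, §4.1 Thm. 4.1 p. 17] -/
theorem roofKernel_eq_of_cw_eq (I : RGDInputsAt F ι₁ Jstar K₀ S hU7ₛ hJ hJu Fi Kc G 𝓜 w hw h𝓨 θ e)
    (hunr : ¬ (w.asIdeal ^ 2 ∣ Ideal.span {(I.pChar : 𝓞 F)}))
    (y t₁ t₂ : AlgPoints (S.M.obj Kc) (AlgebraicClosure (w.adicCompletion F)))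
    (K₁ K₂ : Subgroup ((fibreΩOf S Kc 𝓜 w e I.univ y).Points (AlgebraicClosure (w.adicCompletion F))))
    (h₁ : RoofΩ S Kc 𝓜 w e I.univ I.act I.dual I.pol I.lvl I.pChar w.asIdeal y t₁ K₁)
    (h₂ : RoofΩ S Kc 𝓜 w e I.univ I.act I.dual I.pol I.lvl I.pChar w.asIdeal y t₂ K₂)
    (hK₁ : Nat.card ↥K₁ = I.pChar ^ I.fDeg * I.pChar ^ I.fDeg) (hK₂ : Nat.card ↥K₂ = I.pChar ^ I.fDeg * I.pChar ^ I.fDeg)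
    (hcw : ∀ P : (fibreΩOf S Kc 𝓜 w e I.univ y).Points (AlgebraicClosure (w.adicCompletion F)),
      (P ∈ K₁ ∧ IsIdealTorsionΩ S Kc 𝓜 w e I.univ I.act y ((IsCMField.complexConj F) • w).asIdeal P) ↔
        (P ∈ K₂ ∧ IsIdealTorsionΩ S Kc 𝓜 w e I.univ I.act y ((IsCMField.complexConj F) • w).asIdeal P)) :
    K₁ = K₂ := by
  classical
  haveI : CharZero (w.adicCompletion F) := charZero_of_injective_algebraMap (algebraMap F (w.adicCompletion F)).injective
  haveI : CharZero (AlgebraicClosure (w.adicCompletion F)) :=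
    charZero_of_injective_algebraMap (algebraMap (w.adicCompletion F) (AlgebraicClosure (w.adicCompletion F))).injective
  -- ===================== THE TWO ROOFS =====================
  obtain ⟨B₁, DB₁, lamB₁, hlamB₁, hDB₁, q₁, hq₁, c₁, hc₁, hr1₁, hr2₁, hr2s₁, hr3₁, hr3₁'', hr4₁, -⟩ := h₁
  obtain ⟨B₂, DB₂, lamB₂, hlamB₂, hDB₂, q₂, hq₂, c₂, hc₂, hr1₂, hr2₂, hr2s₂, hr3₂, hr3₂'', hr4₂, -⟩ := h₂
  haveI := hlamB₁; haveI := hq₁; haveI := hc₁; haveI := hlamB₂; haveI := hq₂; haveI := hc₂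
  -- the legs are isogenies
  obtain ⟨hs₁, hf₁, -⟩ := roofΩ_legs_isFinite_surjective' I y t₁ DB₁ lamB₁ hDB₁ q₁ c₁ hr2₁ hr2s₁ hr3₁
  obtain ⟨hs₂, hf₂, -⟩ := roofΩ_legs_isFinite_surjective' I y t₂ DB₂ lamB₂ hDB₂ q₂ c₂ hr2₂ hr2s₂ hr3₂
  haveI := hs₁; haveI := hf₁; haveI := hs₂; haveI := hf₂
  -- (K2-Ω) and (RK) for both legs
  have hK₁' := comp_actΩ_eq_one_of_roofΩ I hunr y t₁ K₁ hK₁ DB₁ lamB₁ hDB₁ q₁ c₁ hr1₁ hr2₁ hr2s₁ hr3₁ hr3₁'' hr4₁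
  have hK₂' := comp_actΩ_eq_one_of_roofΩ I hunr y t₂ K₂ hK₂ DB₂ lamB₂ hDB₂ q₂ c₂ hr1₂ hr2₂ hr2s₂ hr3₂ hr3₂'' hr4₂
  have hkr₁ := finrank_alg_ker_eq_of_roofLeg I y K₁ hK₁ q₁ hr1₁
  have hkr₂ := finrank_alg_ker_eq_of_roofLeg I y K₂ hK₂ q₂ hr1₂
  have hrk₁ : ∀ (K : SchemeOver (AlgebraicClosure (w.adicCompletion F))) [GrpObj K] [IsAffine K.left] [Module.Finite (AlgebraicClosure (w.adicCompletion F)) (Alg K)]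
      (κ : K ⟶ (schΩOf S Kc 𝓜 w e I.univ y).X) [IsMonHom κ] [IsClosedImmersion κ.left],
      (∀ ⦃T : SchemeOver (AlgebraicClosure (w.adicCompletion F))⦄ (t : T ⟶ (schΩOf S Kc 𝓜 w e I.univ y).X), (∃ s : T ⟶ K, s ≫ κ = t) ↔ t ≫ q₁ = 1) →
      Module.finrank (AlgebraicClosure (w.adicCompletion F)) (Alg K) = I.pChar ^ I.fDeg * I.pChar ^ I.fDeg :=
    fun K _ _ _ κ _ _ hκ => finrank_alg_realisation_eq_of_finrank_ker_eq q₁ hkr₁ K κ hκ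
  have hrk₂ : ∀ (K : SchemeOver (AlgebraicClosure (w.adicCompletion F))) [GrpObj K] [IsAffine K.left] [Module.Finite (AlgebraicClosure (w.adicCompletion F)) (Alg K)]
      (κ : K ⟶ (schΩOf S Kc 𝓜 w e I.univ y).X) [IsMonHom κ] [IsClosedImmersion κ.left],
      (∀ ⦃T : SchemeOver (AlgebraicClosure (w.adicCompletion F))⦄ (t : T ⟶ (schΩOf S Kc 𝓜 w e I.univ y).X), (∃ s : T ⟶ K, s ≫ κ = t) ↔ t ≫ q₂ = 1) →
      Module.finrank (AlgebraicClosure (w.adicCompletion F)) (Alg K) = I.pChar ^ I.fDeg * I.pChar ^ I.fDeg :=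
    fun K _ _ _ κ _ _ hκ => finrank_alg_realisation_eq_of_finrank_ker_eq q₂ hkr₂ K κ hκ
  -- ===================== (0) NOTATION AND INSTANCES =====================
  have hp : I.pChar.Prime := I.hpChar.1
  haveI : Fact I.pChar.Prime := ⟨hp⟩
  have hp0 : I.pChar ≠ 0 := hp.ne_zero
  have hp1 : I.pChar ^ 1 ≠ 0 := by rw [pow_one]; exact hp0
  let A₀ : AbelianSchemeOver (Spec (.of (AlgebraicClosure (w.adicCompletion F)))) := schΩOf S Kc 𝓜 w e I.univ y
  let Av : AbelianVariety (AlgebraicClosure (w.adicCompletion F)) := A₀.toAffine.toAbelianVariety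
  let D₀ : A₀.DualPair := dualΩOf S Kc 𝓜 w e I.univ I.dual y
  let pol₀ : A₀.Polarization D₀ := polΩOf S Kc 𝓜 w e I.univ I.pol y
  have hD₀ : Nonempty ((Scheme.Modules.pullback D₀.unitHatSlice).obj D₀.P ≅ SheafOfModules.unit _) := pol₀.nonempty_unitHatSlice_iso
  haveI := pol₀.isMonHom
  let act : 𝓞 F → (Av ⟶ Av) := fun a => actΩOf S Kc 𝓜 w e I.univ I.act a y
  let ρ₀ : A₀.RingAction (𝓞 F) := actΩROf I y
  have hact : ∀ a, (act a).hom.hom.hom = ρ₀.i a := fun a => rfl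
  let cc := IsCMField.complexConj F
  let Iw : Ideal (𝓞 F) := w.asIdeal * (cc • w).asIdeal
  -- ===================== (1) CRT ELEMENTS (★ ED. 4) =====================
  obtain ⟨ew, ecw, hsum1, hIe, hew, hecw, hsq, hst₁, hst₂, hpI, hew𝔮, hecw𝔭⟩ :=
    exists_blockIdempotents_mem w hw I.hpChar.2 hunr (not_sq_conj_dvd_span_of_not_sq_dvd_span w I.pChar hunr)
  -- ===================== (2) THE PINS `G = A_y[p]`, `Ĝ = Â_y[p]` =====================
  obtain ⟨Gp, gi1, gi2, gi3, gi4, gi5, j, hjm, hjci, hG⟩ := Av.exists_torsionPin (N := I.pChar ^ 1) hp1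
  obtain ⟨Ĝ, hi1, hi2, hi3, hi4, hi5, ĵ, hĵm, hĵci, hĜ⟩ := D₀.hat.toAffine.toAbelianVariety.exists_torsionPin (N := I.pChar ^ 1) hp1
  haveI : Mono j := Over.mono_of_mono_left j
  -- ===================== (3) THE LAYER ACTION `β` ON `G` =====================
  obtain ⟨β, hβm, hβ, hNG⟩ := exists_layerEnd_abelianVariety Av (I.pChar ^ 1) Gp j hG act
  haveI : ∀ a, IsMonHom (β a) := hβm
  have hβone : β 1 = 𝟙 Gp := layerEnd_one j (fun a => (act a).hom.hom.hom) β hβ (by rw [hact]; exact ρ₀.i_one)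
  have hβadd : ∀ a b : 𝓞 F, β (a + b) = β a * β b := fun a b =>
    layerEnd_add j (fun a => (act a).hom.hom.hom) β hβ (by rw [hact, hact, hact]; exact ρ₀.i_add a b)
  have hβmul : ∀ a b : 𝓞 F, β (a * b) = β b ≫ β a := fun a b =>
    layerEnd_mul j (fun a => (act a).hom.hom.hom) β hβ (by rw [hact, hact, hact]; exact ρ₀.i_mul a b)
  -- ===================== (4) ROSATI at `A_y` (`rosatiΩ`) =====================
  have hRos : ∀ a : 𝓞 F, (act (cc • a)).hom.hom.hom ≫ pol₀.lam =
      pol₀.lam ≫ DualPair.dualIsogenyOver (A' := (AbelianScheme.ofAbelianVariety Av).toOver) (B := (AbelianScheme.ofAbelianVariety Av).toOver)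
        (act a).hom.hom.hom D₀ D₀ := fun a => rosatiΩ I y a (cc • a) rfl
  -- ===================== (5) `λ_y` KILLS NO POINT OF `A_y[p]` (`polQuasiInvΩ`, Bezout) =====================
  obtain ⟨d, ν, hνm, hpd, hν⟩ := polQuasiInvΩ I y
  haveI := hνm
  have hlamA : ∀ ⦃T : SchemeOver (AlgebraicClosure (w.adicCompletion F))⦄ (s : T ⟶ A₀.X), s ≫ A₀.mulN (I.pChar ^ 1) = 1 → s ≫ pol₀.lam = 1 → s = 1 :=
    fun T s hN hl => F0P6bWDock.eq_one_of_comp_mulN_of_comp_lam A₀ D₀ pol₀.lam (Nat.Coprime.pow_left 1 hpd) _ hν s hN hl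
  have hlam : ∀ ⦃T : SchemeOver (AlgebraicClosure (w.adicCompletion F))⦄ (t : T ⟶ Gp), (t ≫ j) ≫ pol₀.lam = 1 → t = 1 := by
    intro T t ht
    have hq : (t ≫ j) ≫ A₀.mulN (I.pChar ^ 1) = 1 := by
      rw [F0P6bWDock.mulN_eq_zsmul_id]
      exact (hG (t ≫ j)).1 ⟨t, rfl⟩
    have h1 : t ≫ j = (1 : T ⟶ Gp) ≫ j := by
      rw [MonObj.one_comp]
      exact hlamA (t ≫ j) hq ht
    exact (cancel_mono j).1 h1
  -- ===================== (6) `ι(p) = [p]` on `A_y` =====================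
  have hactp : (act (I.pChar : 𝓞 F)).hom.hom.hom = ((((I.pChar ^ 1 : ℕ) : ℤ) • 𝟙 Av).hom.hom.hom) := by
    rw [hact, RingAction.i_natCast, AbelianVariety.hom_zsmul_id, zpow_natCast, pow_one]
    rfl
  -- ===================== (7) (s-H2): THE TWO-BLOCK CUT `G′ = A_y[𝔭_w𝔭_{c•w}]` =====================
  obtain ⟨G', g1, g2, g3, g4, g5, j', hj'm, hj'ci, e𝒟, hem, εW, εV, hεWm, hεVm, hj', hεWj, hεVj, hsumε, hVV, hWW, hadj, hpair⟩ :=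
    DualPair.exists_twoBlock_hermitianDuality_pairing I.pChar Av D₀ hD₀ pol₀ Gp j hG Ĝ ĵ hĜ hlam (𝓞 F) (fun a => cc • a) act β hβ hβone hβadd hβmul
      hRos Iw hpI hactp ew ecw hsum1 hIe hew hecw hsq hst₁ hst₂
  haveI := hj'm; haveI := hj'ci; haveI := hem; haveI := hεWm; haveI := hεVm
  have hG'p : ∀ ⦃T : SchemeOver (AlgebraicClosure (w.adicCompletion F))⦄ (t : T ⟶ G'), (t ≫ j') ^ (I.pChar ^ 1) = 1 := by
    intro T t
    have h := (hj' (t ≫ j')).1 ⟨t, rfl⟩ (I.pChar : 𝓞 F) hpI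
    rwa [hactp, AbelianVariety.hom_zsmul_id, zpow_natCast, MonObj.comp_pow, Category.comp_id] at h
  -- (RKG-Ω) by point count
  have hrkG' := finrank_alg_realisation_mulTorsionΩ_eq I y hpI G' j' hj'
  -- (r4) at `e_{c•w}`: bare intertwiners preserving the unit
  obtain ⟨b₁, hb₁q, -⟩ := hr4₁ ecw
  obtain ⟨b₂, hb₂q, -⟩ := hr4₂ ecw
  haveI := ρ₀.isMonHom_i ecw
  have hb₁ : η[B₁.X] ≫ b₁ = η[B₁.X] := AffineGroupScheme.one_comp_eq_one_of_comm q₁ (act ecw).hom.hom.hom b₁ hb₁q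
  have hb₂ : η[B₂.X] ≫ b₂ = η[B₂.X] := AffineGroupScheme.one_comp_eq_one_of_comm q₂ (act ecw).hom.hom.hom b₂ hb₂q
  -- ===================== (8)–(13) ON Ω̄-POINTS, then (r1) =====================
  ext P
  have key := comp_eq_one_iff_of_two_roofLegs_of_cut I y ecw hecw𝔭 G' j' e𝒟 εW εV hj' hεVj hsumε hVV hadj hpair hG'p hrkG'
    q₁ q₂ DB₁ hDB₁ lamB₁ hr3₁ DB₂ hDB₂ lamB₂ hr3₂ b₁ hb₁ hb₁q b₂ hb₂ hb₂q hK₁' hK₂' K₁ K₂ hr1₁ hr1₂ hcw hrk₁ hrk₂ P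
  exact ((hr1₁ P).symm.trans key).trans (hr1₂ P)

end RoofKernelUnique

end Block_C6Ω

end Summit.HodgeConjecture.HodgeConjecture.Cruxes.HLiu418.F0P6aLineSpecialisation

end
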